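import Summits.ABC.StewartYu.ArchG3StartG
import Summits.ABC.StewartYu.ArchG3VirtualBox
import Summits.ABC.StewartYu.ArchG3SatData
import Summits.ABC.StewartYu.SatBoxTranslate
import HarnessLib

/-!
# Cell abc-stewartyu, rung A1.L (crux r2 `ArchCoreRat`), WP-L.A: the START of the one-stage line AT `S(θ)` — the instance of the generic
# START on the saturated data (floor-free translated `𝔑`-count, virtual slab, virtual denominators, virtual interval box)

`Summits/ABC/StewartYu/ArchG3StartSat.lean` — cell `abc-stewartyu` (HOME `run/shared/lean/pub/abc-stewartyu/`; rulings R32 (a)/(b)/(c1), R34, R37 (i);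
seat lp-1 g8, «MINE ArchG3StartSat» STATUS 2026-08-27).  Theorems on `ArchG3Setup`; no definition, no named fact, no numerics.  Puts together
* p4's floor-free translated count `SatBox.exists_translate_satBox` (a translate `t ∈ ℚⁿ` and a finite set `𝔅 ⊆ ℤⁿ` of θ-exponent vectors with
  VIRTUAL coordinates `ν(μ) = μ ᵥ* U` in `N·t ± N·σ`, `|det C|·∏(2⌊Nσⱼ⌋+1) ≤ Nⁿ·#𝔅`),
* p5's saturated data `F : S.SatData` (`N·Lsum μ = Σⱼ ν(μ)ⱼ log α°ⱼ`, `N·μ = ν(μ) ᵥ* C`, the virtual monomial denominator `Dmv`),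
* the generic START `start_deltaG` / `archLevelStateQ_zeroG` and the virtual family box `VBoxQ` (`vboxQ_of_interval`),
with every coordinate FIXED: the integer virtual interval `[tloⱼ, tloⱼ + Lν 0 j]`, `tloⱼ = ⌈N tⱼ − N σⱼ⌉` (needs `⌊2Nσⱼ⌋ ≤ Lν 0 j`); the slab centre
`cΛ = Σⱼ tⱼ log α°ⱼ` and virtual bound `Θᵥ = Σⱼ σⱼ·Aoⱼ`; the θ-box centre `τₖ = ⌊(Σⱼ tloⱼ C j k)/N⌋` with radius `sₖ`, `Σⱼ Lν 0 j·|C j k| + N ≤ N·sₖ`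
(sizes of the Δ-weights only); the monomial denominator `Dm₀ x = Dmv (Lν 0) x` of differences of members.  The record (seat p1) supplies ONLY
the numbers: the count `2·#E·(2⌈Θᵥ/w₀⌉+1)·Nⁿ ≤ (L₀+1)·|det C|·∏(2⌊Nσⱼ⌋+1)`, the Hasse integrality/size `den₀/M₀`, the Δ-weight bound `DΔ` on the
doubled θ-box, and `DΔ·M₀·Dmv·e^{w₀X₀} ≤ Amax`.

* `archLevelStateQ_zero_sat` — `∃ 𝔏 pv, (∀ i ∈ unkA L₀ 𝔏, i.1 ≤ L₀) ∧ #unkA L₀ 𝔏 ≤ (L₀+1)·∏ⱼ(Lν 0 j + 1) ∧ ArchLevelStateQ (VBoxQ ν Lν) H Ŝ s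
  (unkA L₀ 𝔏) pv ⌈#unkA·Amax⌉ wl γb cl el 0 X₀ T₀` with `ν = vecMulLinear U` as an additive map (the cardinality bound — `ν` is injective
  and lands in the integer box `∏[tloⱼ, tloⱼ + Lν 0 j]` — is what sizes Siegel's `P = ⌈#U·Amax⌉` for the record).

WHAT THIS IS NOT: the record (`ArchG3Rec*`, seat p1), the packages (seat p5), the END (seat p4); no crux moves.

References: Yu. V. Nesterenko, LNM 1819 (2003) §3.3 Prop. 3.4 p. 66–69 (translated box / Blichfeldt), §3.4–3.5 (3.22)–(3.30), Prop. 3.7, 3.9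
p. 69–76 (the lattice 𝔑, Siegel), (3.41)–(3.44) p. 76–78, §4 (4.6) p. 80–81 [Nesterenko2003]; E. M. Matveev, Izv. Math. 64 (2000) §3
[Matveev2000]; K. Yu, Acta Math. 211 (2013) §5.1 [Yu2013].
-/

noncomputable section

open Finset Polynomial
open scoped Matrix
open Literature.NumberTheory.Transcendental
open Literature.NumberTheory.Transcendental.CW77.Setup (Tau tauNorm tauSet)
open Summit.ABC.StewartYu.ArchSupply (scaledFeldR)
open scoped Nat

namespace Summit.ABC.StewartYu

namespace ArchG3Setup

variable (S : ArchG3Setup)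

/-- **THE START AT `S(θ)`** (one-stage line, R32 (a)): from the saturated data `F`, real sides `σ ≥ 0`, α°-weights `Ao`, a virtual-side schedule
`Lν` with `⌊2Nσⱼ⌋ ≤ Lν 0 j`, a θ-radius `s` with `Σⱼ Lν 0 j·|C j k| + N ≤ N·sₖ`, and the record's numbers (count, Hasse integrality and size,
Δ-weight bound, `Amax`), the level-`0` state `ArchLevelStateQ (VBoxQ ν Lν) …` of the schedule on some `U = unkA L₀ 𝔏`, `𝔏` a slab class of
the translated `𝔑`-family. [cite: Nesterenko2003, §3.3 Prop. 3.4, §3.5 (3.22)–(3.30) Prop. 3.9, §4 (4.6), p. 66–81] -/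
theorem archLevelStateQ_zero_sat (F : S.SatData) {Ao : Fin S.n → ℝ} (hAo : ∀ j, |Real.log (F.αo j : ℝ)| ≤ Ao j)
    (σ : Fin S.n → ℝ) (hσ : ∀ j, 0 ≤ σ j) (Lν : ℕ → Fin S.n → ℕ) (hLν0 : ∀ j, ⌊2 * ((F.N : ℝ) * σ j)⌋₊ ≤ Lν 0 j)
    (s : Fin S.n → ℕ) (hs : ∀ k, ∑ j, (Lν 0 j : ℤ) * |F.C j k| + F.N ≤ (F.N : ℤ) * s k)
    (H Sh L₀ X₀ T₀ : ℕ) (hT₀ : 1 ≤ T₀) (wl γb : ℕ → ℝ) (hw : 0 < wl 0) (hγb : 0 ≤ γb 0)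
    (cl : ℕ → ℤ) (el : ℕ → Fin S.n → ℤ) (hc : cl 0 ≠ 0) (he : el 0 S.j₀ = 0)
    (E : Finset (ℤ × Tau S.n)) (hEdef : E = Icc (-(X₀ : ℤ)) X₀ ×ˢ tauSetR S.n S.j₀ T₀)
    (hcount : 2 * E.card * (2 * ⌈(∑ j, σ j * Ao j) / wl 0⌉₊ + 1) * F.N ^ S.n ≤
      (L₀ + 1) * (F.C.det.natAbs * ∏ j, (2 * ⌊(F.N : ℝ) * σ j⌋₊ + 1)))
    (den₀ : ℤ × Tau S.n → ℕ) (hden₀ : ∀ q ∈ E, 1 ≤ den₀ q) (M₀ : ℤ × Tau S.n → ℤ)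
    (hR : ∀ q ∈ E, ∀ ℓ₀ ≤ L₀, ∃ z₀ : ℤ,
      (den₀ q : ℚ) * (hasseDeriv q.2.1 (scaledFeldR ℓ₀ H (Sh - 0))).eval (q.1 : ℚ) = z₀ ∧ |z₀| ≤ M₀ q)
    {DΔ : ℝ} (hDΔ : ∀ w' : Fin S.n → ℤ, (∀ j, |w' j| ≤ ((2 * s j : ℕ) : ℤ)) → ∀ q ∈ E,
      |((∏ k, Ring.multichoose (S.yΔ (cl 0) (el 0) w' k) (q.2.2 k) : ℤ) : ℝ)| ≤ DΔ)
    {Amax : ℝ} (hAmax : 1 ≤ Amax)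
    (hAm : ∀ q ∈ E, DΔ * (M₀ q : ℝ) * (F.Dmv (Lν 0) q.1 : ℝ) * Real.exp (wl 0 * X₀) ≤ Amax) :
    ∃ (𝔏 : Finset (Fin S.n → ℤ)) (pv : ℕ × (Fin S.n → ℤ) → ℤ), (∀ i ∈ S.unkA L₀ 𝔏, i.1 ≤ L₀) ∧
      (S.unkA L₀ 𝔏).card ≤ (L₀ + 1) * ∏ j, (Lν 0 j + 1) ∧
      S.ArchLevelStateQ (S.VBoxQ (Matrix.vecMulLinear F.U).toAddMonoidHom Lν) H Sh s (S.unkA L₀ 𝔏) pv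
        ⌈((S.unkA L₀ 𝔏).card : ℝ) * Amax⌉ wl γb cl el 0 X₀ T₀ := by
  classical
  have hN1 : 1 ≤ F.N := F.hN
  have hN0 : (0 : ℝ) < F.N := F.N_pos'
  have hN0z : (0 : ℤ) < F.N := by exact_mod_cast F.hN
  -- the translated family
  obtain ⟨t, 𝔅, hν, hcard⟩ := SatBox.exists_translate_satBox F.N hN1 F.U F.C F.hCU σ hσ
  -- the integer virtual interval `[tlo, tlo + Lν 0]`
  set tlo : Fin S.n → ℤ := fun j => ⌈(F.N : ℝ) * ((t j : ℚ) : ℝ) - F.N * σ j⌉ with htlo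
  have hint𝔅 : ∀ μ ∈ 𝔅, ∀ j, tlo j ≤ (μ ᵥ* F.U) j ∧ (μ ᵥ* F.U) j ≤ tlo j + (Lν 0 j : ℤ) := by
    intro μ hμ j
    have h := hν μ hμ j
    rw [abs_le] at h
    have h1 : tlo j ≤ (μ ᵥ* F.U) j := by
      simp only [htlo]
      exact Int.ceil_le.mpr (by linarith [h.1])
    refine ⟨h1, ?_⟩
    have h2 : ((F.N : ℝ) * ((t j : ℚ) : ℝ) - F.N * σ j) ≤ (tlo j : ℝ) := by simp only [htlo]; exact Int.le_ceil _
    have h3 : ((((μ ᵥ* F.U) j - tlo j : ℤ)) : ℝ) ≤ 2 * ((F.N : ℝ) * σ j) := by push_cast; linarith [h.2]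
    have h4 : ((μ ᵥ* F.U) j - tlo j).toNat ≤ Lν 0 j := by
      refine le_trans (Nat.le_floor ?_) (hLν0 j)
      have e : ((((μ ᵥ* F.U) j - tlo j).toNat : ℤ) : ℝ) = ((((μ ᵥ* F.U) j - tlo j : ℤ)) : ℝ) := by
        rw [Int.toNat_of_nonneg (by omega)]
      have : ((((μ ᵥ* F.U) j - tlo j).toNat : ℕ) : ℝ) = ((((μ ᵥ* F.U) j - tlo j : ℤ)) : ℝ) := by exact_mod_cast e
      rw [this]; exact h3
    have h5 : (μ ᵥ* F.U) j - tlo j = ((((μ ᵥ* F.U) j - tlo j).toNat : ℕ) : ℤ) := (Int.toNat_of_nonneg (by omega)).symm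
    omega
  -- the θ-box around `τ`
  set aC : Fin S.n → ℤ := fun k => ∑ j, tlo j * F.C j k with haC
  set τ : Fin S.n → ℤ := fun k => aC k / F.N with hτ
  have hθbox : ∀ μ ∈ 𝔅, ∀ k, |μ k - τ k| ≤ (s k : ℤ) := by
    intro μ hμ k
    -- `N μ_k = Σ_j ν_j C_jk`
    have e0 := congrFun (F.N_smul_eq_vecMul_vecMul μ) k
    simp only [Pi.smul_apply, smul_eq_mul] at e0
    have e1 : (F.N : ℤ) * μ k = ∑ j, (μ ᵥ* F.U) j * F.C j k := by rw [e0]; rfl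
    -- `|N μ_k − aC_k| ≤ Σ Lν0_j |C_jk|`
    have e2 : (F.N : ℤ) * μ k - aC k = ∑ j, ((μ ᵥ* F.U) j - tlo j) * F.C j k := by
      rw [e1, haC]; simp only; rw [← sum_sub_distrib]; exact sum_congr rfl fun j _ => by ring
    have hB : |(F.N : ℤ) * μ k - aC k| ≤ ∑ j, (Lν 0 j : ℤ) * |F.C j k| := by
      rw [e2]
      refine (abs_sum_le_sum_abs _ _).trans (sum_le_sum fun j _ => ?_)
      rw [abs_mul]
      refine mul_le_mul_of_nonneg_right ?_ (abs_nonneg _)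
      have := hint𝔅 μ hμ j
      rw [abs_le]; constructor <;> omega
    -- `aC_k = N τ_k + r`, `0 ≤ r < N`
    have hdiv : aC k % F.N + F.N * (aC k / F.N) = aC k := Int.emod_add_mul_ediv (aC k) (F.N : ℤ)
    have hr0 : 0 ≤ aC k - F.N * τ k := by
      have := Int.emod_nonneg (aC k) (ne_of_gt hN0z)
      simp only [hτ]; linarith
    have hr1 : aC k - F.N * τ k < F.N := by
      have := Int.emod_lt_of_pos (aC k) hN0z
      simp only [hτ]; linarith
    -- conclude
    have hmain : (F.N : ℤ) * |μ k - τ k| < F.N * s k := by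
      have e3 : (F.N : ℤ) * (μ k - τ k) = ((F.N : ℤ) * μ k - aC k) + (aC k - F.N * τ k) := by ring
      have h6 : (F.N : ℤ) * |μ k - τ k| = |(F.N : ℤ) * (μ k - τ k)| := by rw [abs_mul, abs_of_pos hN0z]
      rw [h6, e3]
      have h7 := abs_add_le ((F.N : ℤ) * μ k - aC k) (aC k - F.N * τ k)
      have h8 : |aC k - F.N * τ k| < F.N := by rw [abs_of_nonneg hr0]; exact hr1
      have h9 := hs k
      linarith
    exact (lt_of_mul_lt_mul_left hmain hN0z.le).le
  -- the virtual slab bound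
  set cΛ : ℝ := ∑ j, ((t j : ℚ) : ℝ) * Real.log (F.αo j : ℝ) with hcΛ
  have hΘ : ∀ μ ∈ 𝔅, |S.Lsum μ - cΛ| ≤ ∑ j, σ j * Ao j := by
    intro μ hμ
    have e1 : (F.N : ℝ) * (S.Lsum μ - cΛ) = ∑ j, (((μ ᵥ* F.U) j : ℝ) - F.N * ((t j : ℚ) : ℝ)) * Real.log (F.αo j : ℝ) := by
      rw [mul_sub, F.natCast_N_mul_Lsum, hcΛ, mul_sum, ← sum_sub_distrib]
      exact sum_congr rfl fun j _ => by ring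
    have h1 : (F.N : ℝ) * |S.Lsum μ - cΛ| ≤ (F.N : ℝ) * ∑ j, σ j * Ao j := by
      rw [← abs_of_pos hN0, ← abs_mul, abs_of_pos hN0, e1, mul_sum]
      refine (abs_sum_le_sum_abs _ _).trans (sum_le_sum fun j _ => ?_)
      rw [abs_mul]
      have h0 : 0 ≤ Ao j := (abs_nonneg _).trans (hAo j)
      calc |((μ ᵥ* F.U) j : ℝ) - F.N * ((t j : ℚ) : ℝ)| * |Real.log (F.αo j : ℝ)|
          ≤ ((F.N : ℝ) * σ j) * Ao j := mul_le_mul (hν μ hμ j) (hAo j) (abs_nonneg _) (mul_nonneg hN0.le (hσ j))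
        _ = (F.N : ℝ) * (σ j * Ao j) := by ring
    exact le_of_mul_le_mul_left h1 hN0
  -- the count
  have hcount' : 2 * E.card * (2 * ⌈(∑ j, σ j * Ao j) / wl 0⌉₊ + 1) ≤ (L₀ + 1) * 𝔅.card := by
    have hNn : 0 < F.N ^ S.n := pow_pos F.hN _
    have h1 : 2 * E.card * (2 * ⌈(∑ j, σ j * Ao j) / wl 0⌉₊ + 1) * F.N ^ S.n ≤ ((L₀ + 1) * 𝔅.card) * F.N ^ S.n := by
      calc 2 * E.card * (2 * ⌈(∑ j, σ j * Ao j) / wl 0⌉₊ + 1) * F.N ^ S.n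
          ≤ (L₀ + 1) * (F.C.det.natAbs * ∏ j, (2 * ⌊(F.N : ℝ) * σ j⌋₊ + 1)) := hcount
        _ ≤ (L₀ + 1) * (F.N ^ S.n * 𝔅.card) := Nat.mul_le_mul_left _ hcard
        _ = ((L₀ + 1) * 𝔅.card) * F.N ^ S.n := by ring
    exact Nat.le_of_mul_le_mul_right h1 hNn
  -- the monomial denominators of differences of members
  have hdiffbox : ∀ μ ∈ 𝔅, ∀ μ' ∈ 𝔅, ∀ j, |((μ - μ') ᵥ* F.U) j| ≤ (Lν 0 j : ℤ) := by
    intro μ hμ μ' hμ' j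
    rw [Matrix.sub_vecMul, Pi.sub_apply]
    have h1 := hint𝔅 μ hμ j
    have h2 := hint𝔅 μ' hμ' j
    rw [abs_le]; constructor <;> omega
  have hmon₀ : ∀ x : ℤ, |x| ≤ (X₀ : ℤ) → ∀ μ ∈ 𝔅, ∀ μ' ∈ 𝔅,
      ∃ z₂ : ℤ, ((fun x => F.Dmv (Lν 0) x) x : ℚ) * ∏ j, S.α j ^ ((μ j - μ' j) * x) = z₂ := by
    intro x _ μ hμ μ' hμ'
    obtain ⟨z, hz⟩ := F.exists_int_Dmv_mul_prod (hdiffbox μ hμ μ' hμ') x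
    refine ⟨z, ?_⟩
    rw [← hz]
    simp only [Pi.sub_apply]
  -- the family box at level 0
  have hQ0 : ∀ 𝔏 : Finset (Fin S.n → ℤ), 𝔏 ⊆ 𝔅 → ∀ lamb : Fin S.n → ℤ, lamb ∈ 𝔏 →
      S.VBoxQ (Matrix.vecMulLinear F.U).toAddMonoidHom Lν (S.unkA L₀ 𝔏) (fun i => i.2 - lamb) 0 := by
    intro 𝔏 h𝔏 lamb hlamb
    refine S.vboxQ_of_interval tlo (S.unkA L₀ 𝔏) (fun i hi j => ?_) lamb (fun j => ?_)
    · have := hint𝔅 i.2 (h𝔏 (S.mem_unkA.mp hi).2) j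
      simpa only [LinearMap.toAddMonoidHom_coe, Matrix.vecMulLinear_apply] using this
    · have := hint𝔅 lamb (h𝔏 hlamb) j
      simpa only [LinearMap.toAddMonoidHom_coe, Matrix.vecMulLinear_apply] using this
  -- the generic START
  obtain ⟨𝔏, pv, h𝔏𝔅, hst⟩ := S.archLevelStateQ_zeroG s τ hθbox hΘ H Sh L₀ X₀ T₀ hT₀ hQ0 wl γb hw hγb cl el hc he E hEdef hcount'
    den₀ hden₀ M₀ hR hDΔ (fun x => F.Dmv (Lν 0) x) (fun x => F.one_le_Dmv _ x) hmon₀ hAmax hAm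
  -- the cardinality of the unknown set: `ν` is injective into the integer box `∏ [tlo, tlo + Lν 0]`
  have hcardU : (S.unkA L₀ 𝔏).card ≤ (L₀ + 1) * ∏ j, (Lν 0 j + 1) := by
    rw [S.card_unkA]
    refine Nat.mul_le_mul_left _ ?_
    set VB : Finset (Fin S.n → ℤ) := Fintype.piFinset fun j => Icc (tlo j) (tlo j + (Lν 0 j : ℤ)) with hVB
    have hVBcard : VB.card = ∏ j, (Lν 0 j + 1) := by
      rw [hVB, Fintype.card_piFinset]
      refine prod_congr rfl fun j _ => ?_
      rw [Int.card_Icc]; omega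
    have hmap : ∀ μ ∈ 𝔏, (fun μ : Fin S.n → ℤ => μ ᵥ* F.U) μ ∈ VB := by
      intro μ hμ
      rw [hVB, Fintype.mem_piFinset]
      intro j
      rw [mem_Icc]
      exact hint𝔅 μ (h𝔏𝔅 hμ) j
    have hinj : Set.InjOn (fun μ : Fin S.n → ℤ => μ ᵥ* F.U) ↑𝔏 := by
      intro μ _ μ' _ hμμ'
      have h1 : (F.N : ℤ) • μ = (F.N : ℤ) • μ' := by
        rw [F.N_smul_eq_vecMul_vecMul μ, F.N_smul_eq_vecMul_vecMul μ']
        simp only at hμμ'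
        rw [hμμ']
      funext k
      have h2 := congrFun h1 k
      simp only [Pi.smul_apply, smul_eq_mul] at h2
      exact mul_left_cancel₀ (ne_of_gt hN0z) h2
    rw [← hVBcard]
    exact card_le_card_of_injOn _ hmap hinj
  exact ⟨𝔏, pv, fun i hi => (S.mem_unkA.mp hi).1, hcardU, hst⟩

end ArchG3Setup

end Summit.ABC.StewartYu

end
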